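import Summits.Ventures.YMGap.YM3IR.ForestDisintegration

/-!
# YM3IR / ForestLocality — the forest average is LOCAL and BOUNDED (clause (b)(ii) data for the forest, kernel form)

HONEST FRAMING.  Elementary support bookkeeping for the cell's track-Y4 audit of `IRConjecture3` (companion of
`YM3IR/ForestAudit.lean`, `ForestHaar.lean`, `ForestDisintegration.lean`).  NOTHING here is about Yang–Mills dynamics:
no mass gap, no continuum statement, no smallness, no decay estimate, no claim on any conjecture-labelled item, and the
block MAP concerned (`starDecimation`, the forest) is NOT gauge-covariant (theory-1's `YM3IR/CovariantFamily.lean`) — this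
file says nothing about covariant (Bałaban-type) block maps, for which clause (b) is a genuine constrained-mixing statement.

CONTENT (torus of side `b·M`; the analysis lemmas hold for ANY law `ν`, the packaged statement for the Wilson law with
`2 ≤ b`, every `M ≥ 1`, every `β`, continuous `ρ`, compact second-countable `G`):
* `endpointStars Δ` — the coarse edges issuing from the blocks of the endpoints of the edges of `Δ`;
  `endpointStars_subset_coarseHull : endpointStars Δ ⊆ coarseHull Δ 1` (one fine link moves the block label by a
  `{0,1}`-vector, `blockOf_shift_sub_apply`, with torus wrap-around).
* `dependsOn_forestAverage` / `dependsOn_forestCov` — LOCALITY: if `f` depends only on the links of `Δ`, its forest average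
  `Ψ_f = forestAverage … f` depends only on the forest field on `endpointStars Δ` (the leaf rotation at a site reads one star
  link of that site's block: `leafGauge_congr`); `abs_forestAverage_le` — `sup |Ψ_f| ≤ sup |f|`; `measurable_forestAverage`.
* `forest_condExp_local_data` / `forestFamily_condExp_local_data` — PACKAGED: for bounded measurable `f` supported in `Δf`
  and every `R ≥ 1` there are `h` (namely `Ψ_f`) and a finite `Δh ⊆ coarseHull Δf R` with `h` measurable, `DependsOn h Δh`,
  `sup |h| ≤ sup |f|` and `E[f | coarseSigma] = h ∘ blk` ALMOST SURELY WITH ERROR ZERO — literally the `∃ h Δh, …` data of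
  clause (b)(ii) of `FluctuationDecouplingAt` for `forestFamily`, except the Lipschitz-load inequality `Σ δh ≤ c Σ δf`
  (needs a bi-invariant `r`; counted on paper in the cell audit, AUDIT-theory2-g4.md §2.4) which is NOT typed here.

USE (cell-internal).  Closes, in the kernel, the locality half of the audit's §2.4: together with `ForestHaar.lean`
(clause (a) for the forest = product Haar ∈ tier-1 ball) and `ForestDisintegration.lean` (exact conditional objects), the
only part of the forest witness for `IRConjecture3` (b) left on paper is the Lipschitz-load count and the transport of the
fine theory's OWN exponential clustering through the leaf rotation (clause (b)(i)).  This is the precise sense of the audit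
finding «as typed, clause (b) for a loop-free block map is the fine theory's clustering, not a renormalisation-group input».

## References
* M. Creutz, *Quarks, Gluons and Lattices* (1983), eq. (9.19) (axial/tree gauge: links of a maximal tree set to `1`).
* I. Montvay, G. Münster, *Quantum Fields on a Lattice* (1994), §3.2.5 (maximal trees, gauge fixing on the lattice).
* K. G. Wilson, Phys. Rev. D 10 (1974) 2445 (the plaquette action). [cite: Wilson1974]
-/

noncomputable section

open MeasureTheory
open Literature.MathematicalPhysics.QuantumFieldTheory

namespace Summit.Ventures.YMGap.YM3IR

section ForestLocality

variable {G : Type} [Group G] {b M : ℕ}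

/-- The coarse edges issuing from the block of an endpoint of an edge of `Δ`: where the forest average of an observable
supported in `Δ` lives (only the leaf-rotation values `leafGauge s x` at endpoints `x` of edges of `Δ` enter, and each reads
`s` on one star link of the block of `x`). [folklore] -/
def endpointStars (b M : ℕ) (Δ : Set (Edge 3 (b * M))) : Set (Edge 3 M) :=
  {e | ∃ x ∈ Δ, e.1 = blockOf b M x.1 ∨ e.1 = blockOf b M (x.1.shift x.2)}

/-- `endpointStars` is monotone in the support. [folklore] -/
theorem endpointStars_mono {Δ Δ' : Set (Edge 3 (b * M))} (h : Δ ⊆ Δ') :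
    endpointStars b M Δ ⊆ endpointStars b M Δ' := by
  rintro e ⟨x, hx, he⟩
  exact ⟨x, h hx, he⟩

/-- The leaf rotation at a fine site `x` reads the forest field only on the star of the block of `x`. [folklore] -/
theorem leafGauge_congr {s s' : Edge 3 M → G} {x : Site 3 (b * M)}
    (h : ∀ i, s (blockOf b M x, i) = s' (blockOf b M x, i)) : leafGauge b M s x = leafGauge b M s' x := by
  unfold leafGauge
  by_cases hx : ∃ i : Fin 3, (x i).val % b = 1 ∧ ∀ j, j ≠ i → (x j).val % b = 0
  · simp only [dif_pos hx, h]
  · simp only [dif_neg hx]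

/-- The rotated link `(a^{leafGauge s})(e)` reads the forest field only on the stars of the blocks of the two endpoints
of `e`. [folklore] -/
theorem gaugeTransform_leafGauge_apply_congr {s s' : Edge 3 M → G} (a : GaugeConfig 3 (b * M) G)
    {e : Edge 3 (b * M)} (h₁ : ∀ i, s (blockOf b M e.1, i) = s' (blockOf b M e.1, i))
    (h₂ : ∀ i, s (blockOf b M (e.1.shift e.2), i) = s' (blockOf b M (e.1.shift e.2), i)) :
    gaugeTransform (leafGauge b M s) a e = gaugeTransform (leafGauge b M s') a e := by
  show leafGauge b M s e.1 * a e * (leafGauge b M s (e.1.shift e.2))⁻¹ =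
    leafGauge b M s' e.1 * a e * (leafGauge b M s' (e.1.shift e.2))⁻¹
  rw [leafGauge_congr h₁, leafGauge_congr h₂]

section Analysis

variable [MeasurableSpace G]

/-- **LOCALITY OF THE FOREST AVERAGE.** If `f` depends only on the links in `Δ`, its forest average `Ψ_f` depends only on
the forest field on `endpointStars Δ` — for ANY law `ν` (no property of the Wilson law is used). [folklore] -/
theorem dependsOn_forestAverage (ν : Measure (GaugeConfig 3 (b * M) G)) {f : GaugeConfig 3 (b * M) G → ℝ}
    {Δ : Set (Edge 3 (b * M))} (hf : DependsOn f Δ) :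
    DependsOn (forestAverage b M ν f) (endpointStars b M Δ) := by
  intro s s' hss'
  unfold forestAverage
  congr 1
  funext a
  exact hf fun e he => gaugeTransform_leafGauge_apply_congr a (fun i => hss' _ ⟨e, he, Or.inl rfl⟩)
    (fun i => hss' _ ⟨e, he, Or.inr rfl⟩)

/-- Locality of the forest covariance: `forestCov f g` depends only on the forest field on `endpointStars (Δf ∪ Δg)`.
[folklore] -/
theorem dependsOn_forestCov (ν : Measure (GaugeConfig 3 (b * M) G)) {f g : GaugeConfig 3 (b * M) G → ℝ}
    {Δf Δg : Set (Edge 3 (b * M))} (hf : DependsOn f Δf) (hg : DependsOn g Δg) :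
    DependsOn (forestCov b M ν f g) (endpointStars b M (Δf ∪ Δg)) := by
  have hf' : DependsOn f (Δf ∪ Δg) := fun x y hxy => hf fun i hi => hxy i (Or.inl hi)
  have hg' : DependsOn g (Δf ∪ Δg) := fun x y hxy => hg fun i hi => hxy i (Or.inr hi)
  have hfg : DependsOn (fun U => f U * g U) (Δf ∪ Δg) := fun x y hxy => by
    show f x * g x = f y * g y
    rw [hf' hxy, hg' hxy]
  intro s s' hss'
  unfold forestCov
  rw [dependsOn_forestAverage ν hfg hss', dependsOn_forestAverage ν hf' hss', dependsOn_forestAverage ν hg' hss']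

/-- **BOUNDEDNESS OF THE FOREST AVERAGE**: `sup |Ψ_f| ≤ sup |f|` for a probability law `ν`. [folklore] -/
theorem abs_forestAverage_le (ν : Measure (GaugeConfig 3 (b * M) G)) [IsProbabilityMeasure ν]
    {f : GaugeConfig 3 (b * M) G → ℝ} {C : ℝ} (hC : ∀ U, |f U| ≤ C) (s : GaugeConfig 3 M G) :
    |forestAverage b M ν f s| ≤ C := by
  have h := norm_integral_le_of_norm_le_const (μ := ν)
    (f := fun a => f (gaugeTransform (leafGauge b M s) a)) (C := C)
    (Filter.Eventually.of_forall fun a => by rw [Real.norm_eq_abs]; exact hC _)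
  simpa [Real.norm_eq_abs, forestAverage] using h

variable {N : ℕ} [TopologicalSpace G] [IsTopologicalGroup G] [BorelSpace G] [SecondCountableTopology G]

/-- **MEASURABILITY OF THE FOREST AVERAGE** in the forest field, for an s-finite law and measurable `f`. [folklore] -/
theorem measurable_forestAverage (ν : Measure (GaugeConfig 3 (b * M) G)) [SFinite ν]
    {f : GaugeConfig 3 (b * M) G → ℝ} (hfm : Measurable f) : Measurable (forestAverage b M ν f) :=
  ((hfm.comp measurable_gaugeTransform_leafGauge).stronglyMeasurable.integral_prod_left' (μ := ν)).measurable

/-- Measurability of the forest covariance. [folklore] -/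
theorem measurable_forestCov (ν : Measure (GaugeConfig 3 (b * M) G)) [SFinite ν]
    {f g : GaugeConfig 3 (b * M) G → ℝ} (hfm : Measurable f) (hgm : Measurable g) :
    Measurable (forestCov b M ν f g) :=
  (measurable_forestAverage ν (hfm.mul hgm)).sub ((measurable_forestAverage ν hfm).mul (measurable_forestAverage ν hgm))

end Analysis

section Geometry

variable [NeZero M]

/-- Crossing one fine link changes the block label by `0` or `1` in each coordinate (with wrap-around on the torus).
[folklore] -/
theorem blockOf_shift_sub_apply (hb : 0 < b) (x : Site 3 (b * M)) (i j : Fin 3) :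
    (blockOf b M (x.shift i) - blockOf b M x) j = 0 ∨ (blockOf b M (x.shift i) - blockOf b M x) j = 1 := by
  simp only [Pi.sub_apply, blockOf, Site.shift, Pi.add_apply]
  by_cases hj : j = i
  · subst hj
    rw [Pi.single_eq_same]
    have hM : 1 ≤ M := Nat.pos_of_ne_zero (NeZero.ne M)
    haveI : NeZero (b * M) := ⟨Nat.mul_ne_zero hb.ne' (NeZero.ne M)⟩
    set u := x j with hu
    rcases Nat.lt_or_ge (u.val + 1) (b * M) with h | h
    · have h1 : (1 : ZMod (b * M)).val = 1 := by
        rw [ZMod.val_one_eq_one_mod]; exact Nat.mod_eq_of_lt (by omega)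
      have hval : (u + 1).val = u.val + 1 := by
        rw [ZMod.val_add_of_lt (by rw [h1]; exact h), h1]
      rw [hval, Nat.succ_div]
      by_cases hd : b ∣ u.val + 1
      · right
        rw [if_pos hd]; push_cast; ring
      · left
        rw [if_neg hd]; simp
    · have hlt : u.val < b * M := ZMod.val_lt u
      have heq : u.val + 1 = b * M := le_antisymm hlt h
      have hu0 : u + 1 = 0 := by
        have h0 : ((u.val + 1 : ℕ) : ZMod (b * M)) = 0 := by rw [heq, ZMod.natCast_self]
        simpa [ZMod.natCast_zmod_val] using h0
      rw [hu0, ZMod.val_zero, Nat.zero_div]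
      have hq : u.val / b = M - 1 := by
        apply Nat.div_eq_of_lt_le
        · rw [Nat.sub_one_mul, Nat.mul_comm M b]; omega
        · rw [Nat.sub_add_cancel hM, Nat.mul_comm M b]; omega
      rw [hq]
      right
      rw [Nat.cast_sub hM, ZMod.natCast_self]; simp
  · left
    rw [Pi.single_eq_of_ne hj, add_zero, sub_self]

/-- `|valMinAbs 1| ≤ 1` in `ZMod M` (it is `0` for `M = 1`). [folklore] -/
theorem natAbs_valMinAbs_one_le_one : ((1 : ZMod M).valMinAbs).natAbs ≤ 1 := by
  rcases Nat.lt_or_ge M 2 with hM | hM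
  · have hM1 : M = 1 := by have := NeZero.ne M; omega
    subst hM1
    rw [show (1 : ZMod 1) = 0 from Subsingleton.elim _ _, ZMod.valMinAbs_zero]; simp
  · have h := ZMod.valMinAbs_natCast_of_le_half (n := M) (a := 1) ((Nat.le_div_iff_mul_le two_pos).mpr (by omega))
    rw [Nat.cast_one] at h
    rw [h]; simp

/-- The block of the far endpoint of a fine link is within coarse sup-distance `1` of the block of its base point.
[folklore] -/
theorem torusNorm_blockOf_shift_sub_le (hb : 0 < b) (x : Site 3 (b * M)) (i : Fin 3) :
    torusNorm (blockOf b M (x.shift i) - blockOf b M x) ≤ 1 := by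
  refine Finset.sup_le fun j _ => ?_
  rcases blockOf_shift_sub_apply hb x i j with h | h
  · rw [h, ZMod.valMinAbs_zero]; simp
  · rw [h]; exact natAbs_valMinAbs_one_le_one

/-- **SUPPORT OF THE FOREST AVERAGE**: `endpointStars Δ ⊆ coarseHull Δ 1` — the forest average of an observable
supported in `Δ` lives within coarse distance `1` of the blocks met by `Δ` (clause (b)(ii) of `IRConjecture3` asks for
`⊆ coarseHull Δ R`). [folklore] -/
theorem endpointStars_subset_coarseHull (hb : 0 < b) (Δ : Finset (Edge 3 (b * M))) :
    endpointStars b M (↑Δ : Set (Edge 3 (b * M))) ⊆ coarseHull b M Δ 1 := by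
  rintro e ⟨x, hx, h | h⟩
  · exact ⟨x, hx, by rw [h, sub_self, torusNorm_zero]; exact Nat.zero_le _⟩
  · exact ⟨x, hx, by rw [h]; exact torusNorm_blockOf_shift_sub_le hb x.1 x.2⟩

end Geometry

end ForestLocality

section Package

variable {G : Type} [MeasurableSpace G] {N : ℕ} [Group G] [TopologicalSpace G] [IsTopologicalGroup G]
  [BorelSpace G] {b M : ℕ} [SecondCountableTopology G] [NeZero M] [CompactSpace G]

/-- **THE DATA OF CLAUSE (b)(ii) FOR THE FOREST, EXACT (error ZERO) for every `R ≥ 1`.** Under the Wilson law on the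
torus of side `b·M` (`2 ≤ b`, every `M ≥ 1`, every `β`, continuous `ρ`), for every bounded measurable `f` supported in
`Δf`: `h := Ψ_f` (the forest average against the law of the forest gauge fixing) is measurable, depends only on the forest
field on a finite set `Δh ⊆ coarseHull Δf R`, satisfies `sup |h| ≤ sup |f|`, and `E[f | σ(starDecimation)] = h ∘ starDecimation`
a.s.  What is NOT typed here: the Lipschitz-load count `Σ δh ≤ c · Σ δf` of clause (b)(ii) (it needs a bi-invariant `r`;
paper count in the cell audit §2.4) and the case `R = 0`. [folklore] -/
theorem forest_condExp_local_data (ρ : G →* Matrix (Fin N) (Fin N) ℂ) (hρ : Continuous ρ) (hb : 2 ≤ b)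
    [NeZero (b * M)] (β : ℝ) {f : GaugeConfig 3 (b * M) G → ℝ} (hfm : Measurable f) {C : ℝ} (hC : ∀ U, |f U| ≤ C)
    {Δf : Finset (Edge 3 (b * M))} (hf : DependsOn f (↑Δf : Set (Edge 3 (b * M)))) {R : ℕ} (hR : 1 ≤ R) :
    ∃ (h : GaugeConfig 3 M G → ℝ) (Δh : Finset (Edge 3 M)),
      Measurable h ∧ DependsOn h (↑Δh : Set (Edge 3 M)) ∧ (↑Δh : Set (Edge 3 M)) ⊆ coarseHull b M Δf R ∧
      (∀ s, |h s| ≤ C) ∧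
      condExp (MeasurableSpace.comap (starDecimation (G := G) b M) inferInstance)
          (wilsonMeasure (d := 3) (L := b * M) ρ β) f
        =ᵐ[wilsonMeasure (d := 3) (L := b * M) ρ β] fun U => h (starDecimation b M U) := by
  classical
  haveI := isProbabilityMeasure_wilsonMeasure (d := 3) (L := b * M) (G := G) ρ hρ β
  set ν := (wilsonMeasure (d := 3) (L := b * M) ρ β).map (forestFix b M) with hν
  haveI : IsProbabilityMeasure ν :=
    Measure.isProbabilityMeasure_map (measurable_forestFix (G := G) (b := b) (M := M)).aemeasurable
  have hfi : Integrable f (wilsonMeasure (d := 3) (L := b * M) ρ β) :=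
    Integrable.of_bound hfm.aestronglyMeasurable C (Filter.Eventually.of_forall fun U => by
      rw [Real.norm_eq_abs]; exact hC U)
  refine ⟨forestAverage b M ν f, (Set.toFinite (endpointStars b M (↑Δf : Set (Edge 3 (b * M))))).toFinset,
    measurable_forestAverage ν hfm, ?_, ?_, abs_forestAverage_le ν hC, ?_⟩
  · rw [Set.Finite.coe_toFinset]; exact dependsOn_forestAverage ν hf
  · rw [Set.Finite.coe_toFinset]
    exact (endpointStars_subset_coarseHull (by omega) Δf).trans fun e ⟨x, hx, hxe⟩ => ⟨x, hx, hxe.trans hR⟩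
  · exact condExp_forest_ae_eq_forestAverage ρ hρ hb β hfm hfi

/-- The same, phrased with the tree's `coarseSigma` / `fineLaw` / `BlockFamily.blk` of `forestFamily` — literally the
`∃ h Δh, Measurable h ∧ DependsOn h ↑Δh ∧ ↑Δh ⊆ coarseHull _ _ Δf R ∧ …` data of `FluctuationDecouplingAt` (b)(ii), with the
approximation error identically `0` (so any `c ≥ 0`, `κ` work for that inequality) and `sup |h| ≤ sup |f|`; the Lipschitz
loads are not typed. [folklore] -/
theorem forestFamily_condExp_local_data (ρ : G →* Matrix (Fin N) (Fin N) ℂ) (hρ : Continuous ρ)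
    {bf : ℝ → ℕ} (hbf : ∀ β, 0 < bf β) (β : ℝ) (h2 : 2 ≤ bf β) [NeZero (bf β * M)]
    {f : GaugeConfig 3 (bf β * M) G → ℝ} (hfm : Measurable f) {C : ℝ} (hC : ∀ U, |f U| ≤ C)
    {Δf : Finset (Edge 3 (bf β * M))} (hf : DependsOn f (↑Δf : Set (Edge 3 (bf β * M)))) {R : ℕ} (hR : 1 ≤ R) :
    ∃ (h : GaugeConfig 3 M G → ℝ) (Δh : Finset (Edge 3 M)),
      Measurable h ∧ DependsOn h (↑Δh : Set (Edge 3 M)) ∧ (↑Δh : Set (Edge 3 M)) ⊆ coarseHull _ _ Δf R ∧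
      (∀ s, |h s| ≤ C) ∧
      condExp (coarseSigma (forestFamily bf hbf) β M) (fineLaw ρ β (forestFamily bf hbf) M) f
        =ᵐ[fineLaw ρ β (forestFamily bf hbf) M] fun U => h ((forestFamily bf hbf).blk β M U) :=
  forest_condExp_local_data ρ hρ h2 β hfm hC hf hR

end Package

end Summit.Ventures.YMGap.YM3IR

end
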